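import Literature.Geometry.Symplectic.OpenBookTubeFrames
import HarnessLib

/-!
# A Giroux form sees an open book only through its binding `B` and its fibration `π`

Topic `Literature/Geometry/Symplectic`; an API file (everything PROVED, no definitions, no named
facts) for the open books `OpenBook M` and Giroux forms `OpenBook.IsGirouxForm` of
`PlanarContactBoundary.lean`.

The tree's `OpenBook M` is Wendl's form of Etnyre's Def. 2.1: the pair `(B, π)` is recorded
together with a CHOICE of tubes `tube i : 𝕊¹ × ℝ² → M` around the binding components in which
`π (tube i (x, w)) = w / ‖w‖`.  The printed notion "the contact structure `ξ` is supported by the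
open book `(B, π)`" (Giroux 2002; Etnyre 2006, Def. 3.2; Wendl 2020, p. 77) depends on `(B, π)`
only, whereas the tree's `OpenBook.IsGirouxForm ob ξ α` reads its binding condition
`α(b) · (α ∧ dα)(b, e₁, e₂) > 0` on the frame `(b, e₁, e₂) = (∂_x tube, ∂_{w₁} tube, ∂_{w₂} tube)`
of the chosen tubes.  This file proves that nothing is lost:

* `OpenBook.IsGirouxForm.of_binding_eq_of_proj_eq` — if `ob` and `ob'` are open books of the
  same Hausdorff `3`-manifold with the same binding and the same fibration off the binding, every
  Giroux form of `ob` (for any plane field `ξ`) is a Giroux form of `ob'`;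
  `OpenBook.isGirouxForm_iff_of_binding_eq_of_proj_eq`,
  `OpenBook.Supports.of_binding_eq_of_proj_eq`.

Use: named facts that quantify over ALL open books with prescribed `(B, π)` — e.g.
`Literature.Geometry.Symplectic.palf_stein_supportedByBoundaryOpenBook` (its hypothesis
`IsKasOpenBookOf` pins exactly the binding and the fibration of the Kas boundary open book of a
Lefschetz handlebody; it is the contact-topological input of
`Literature.Geometry.Symplectic.steinRealisation_of_sorted_modelsOnFibred`) — are thereby reduced
to ONE open book with that `(B, π)`.

## The proof

The `pages` condition involves only `dθ = π^* dθ` at points off `B`, which is local in `π`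
(`OpenBook.angularDeriv_eq_of_eqOn`).  For the `binding` condition at
`p = tube' i (x', 0) = tube j (x, 0)` let `q = qmap j : M → ℝ²` be the disc coordinate of the
`j`-th tube of `ob` (`GirouxContactPathTube.lean`), smooth near `p`, and
`Q = q ∘ param' i : ℝ³ → ℝ²` (`param' i (ψ, w) = tube' i (e^{iψ}, w)`).  Since the cores agree
near `p`, `Q(ψ, 0) = 0` and `dQ(e₀) = 0`; since both tubes have the normal form for the SAME
`π`, `Q(ψ', w) / ‖Q(ψ', w)‖ = w / ‖w‖` for small `w ≠ 0`, so `dQ(0, w)` is a non-negative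
multiple of `w` (`fderiv_apply_direction_of_eventually`, `OpenBookTubeFrames.lean`).  With
`dq(b) = 0`, `dq(e₁) = (1, 0)`, `dq(e₂) = (0, 1)` and `det(b, e₁, e₂) ≠ 0` (the Giroux condition
of `ob` at `p`) this gives `b' = a b`, `e₁' = μ₁ e₁ + c₁ b`, `e₂' = μ₂ e₂ + c₂ b` with
`μ₁, μ₂ > 0` and `a ≠ 0` (the differential of the embedding `tube' i` is injective), whence
`α(b') (α ∧ dα)(b', e₁', e₂') = a² μ₁ μ₂ · α(b) (α ∧ dα)(b, e₁, e₂) > 0`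
(`(α ∧ dα)(u, v, w) = det(u, v, w) · vol`, `GrayMoser.wedge₁₂_eq_det3_mul_vol`).

## References

* J. B. Etnyre, *Lectures on open book decompositions and contact structures*, Clay Math. Proc.
  5 (2006), Def. 2.1, Def. 3.2. [Etnyre2006]
* C. Wendl, *Lectures on Contact 3-Manifolds, Holomorphic Curves and Intersection Theory*
  (2020), §5.1, p. 77. [Wendl2020]
-/

noncomputable section

open scoped Manifold ContDiff Topology
open Set Function Filter
open Literature.Geometry.Kaehler Literature.Topology.FourManifolds

namespace Literature.Geometry.Symplectic

universe u

variable {M : Type u} [TopologicalSpace M] [ChartedSpace (EuclideanSpace ℝ (Fin 3)) M]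
  [IsManifold (𝓡 3) ∞ M]

namespace OpenBook

/-- **The binding condition of a Giroux form transfers between open books with the same binding
and the same fibration.**  If `α` is a Giroux form of `ob`, and `ob'` has the same binding and
the same fibration off the binding, then `α(b') · (α ∧ dα)(b', e₁', e₂') > 0` on the core frame
`(b', e₁', e₂') = (∂_x tube' i, ∂_{w₁} tube' i, ∂_{w₂} tube' i)` of every tube of `ob'` (see the
module docstring for the proof). [cite: Etnyre2006, Def. 3.2] -/
theorem IsGirouxForm.binding_of_binding_eq_of_proj_eq [T2Space M] {ob ob' : OpenBook M}
    {ξ : M → Submodule ℝ (EuclideanSpace ℝ (Fin 3))} {α : MForm (𝓡 3) M ℝ 1}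
    (h : ob.IsGirouxForm ξ α) (hB : ob'.binding = ob.binding)
    (hπ : ∀ y, y ∉ ob.binding → ob'.proj y = ob.proj y)
    (i : Fin ob'.k) (x' : Metric.sphere (0 : EuclideanSpace ℝ (Fin 2)) 1) :
    0 < α (ob'.tube i (x', 0)) ![ob'.coreTangent i x'] *
      wedge₁₂ (α (ob'.tube i (x', 0))) (mextDeriv α (ob'.tube i (x', 0)))
        (ob'.coreTangent i x') (ob'.discFrame i x' 0) (ob'.discFrame i x' 1) := by
  obtain ⟨ψ', rfl⟩ := circlePoint_surjective x'
  -- the point `p` of the binding and a tube `j` of `ob` through it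
  set p : M := ob'.tube i (circlePoint ψ', 0) with hp
  have hpB : p ∈ ob.binding := hB ▸ ob'.core_mem_binding i (circlePoint ψ')
  obtain ⟨j, x, hjx⟩ := (ob.mem_binding_iff p).1 hpB
  obtain ⟨ψ, rfl⟩ := circlePoint_surjective x
  have hprange : p ∈ range (ob.tube j) := ⟨_, hjx⟩
  have hpar' : ob'.param i (mk3 ψ' 0) = p := by rw [param_mk3]
  -- the differential `Dq` at `p` of the disc coordinate `q = qmap j` of `ob`, on `ob`'s frame
  set Dq : EuclideanSpace ℝ (Fin 3) →L[ℝ] EuclideanSpace ℝ (Fin 2) :=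
    mfderiv (𝓡 3) 𝓘(ℝ, EuclideanSpace ℝ (Fin 2)) (ob.qmap j) p with hDq
  have hDb : Dq (ob.coreTangent j (circlePoint ψ)) = 0 := by
    have h1 := ob.mfderiv_qmap_coreTangent j ψ
    rwa [hjx] at h1
  have hDe₁ : Dq (ob.discFrame j (circlePoint ψ) 0) = EuclideanSpace.single 0 1 := by
    have h1 := ob.mfderiv_qmap_discFrame_zero j ψ
    rwa [hjx] at h1
  have hDe₂ : Dq (ob.discFrame j (circlePoint ψ) 1) = EuclideanSpace.single 1 1 := by
    have h1 := ob.mfderiv_qmap_discFrame_one j ψ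
    rwa [hjx] at h1
  -- the Giroux binding condition of `ob` at `p`, and `det(b, e₁, e₂) ≠ 0`
  have hbind := h.binding j (circlePoint ψ)
  rw [hjx] at hbind
  have hdet : GrayMoser.det3 (ob.coreTangent j (circlePoint ψ)) (ob.discFrame j (circlePoint ψ) 0)
      (ob.discFrame j (circlePoint ψ) 1) ≠ 0 := by
    intro h0
    rw [GrayMoser.wedge₁₂_eq_det3_mul_vol, h0, zero_mul, mul_zero] at hbind
    exact lt_irrefl _ hbind
  -- the composite `Q = q ∘ param' i : ℝ³ → ℝ²`, differentiable at `p₀' = (ψ', 0, 0)`, `Q p₀' = 0`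
  set Q : EuclideanSpace ℝ (Fin 3) → EuclideanSpace ℝ (Fin 2) := ob.qmap j ∘ ob'.param i with hQ
  have hqd : MDifferentiableAt (𝓡 3) 𝓘(ℝ, EuclideanSpace ℝ (Fin 2)) (ob.qmap j)
      (ob'.param i (mk3 ψ' 0)) :=
    (ob.contMDiffAt_qmap j (by rw [hpar']; exact hprange)).mdifferentiableAt (by simp)
  have hpd : MDifferentiableAt (𝓡 3) (𝓡 3) (ob'.param i) (mk3 ψ' 0) :=
    (ob'.contMDiff_param i (mk3 ψ' 0)).mdifferentiableAt (by simp)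
  have hQd : MDifferentiableAt (𝓡 3) 𝓘(ℝ, EuclideanSpace ℝ (Fin 2)) Q (mk3 ψ' 0) := hqd.comp _ hpd
  set L : EuclideanSpace ℝ (Fin 3) →L[ℝ] EuclideanSpace ℝ (Fin 2) :=
    mfderiv (𝓡 3) 𝓘(ℝ, EuclideanSpace ℝ (Fin 2)) Q (mk3 ψ' 0) with hL
  have hLf : HasFDerivAt Q L (mk3 ψ' 0) := by
    have h1 := (mdifferentiableAt_iff_differentiableAt.1 hQd).hasFDerivAt
    rwa [← mfderiv_eq_fderiv] at h1
  have hchain : ∀ v, L v = Dq (mfderiv (𝓡 3) (𝓡 3) (ob'.param i) (mk3 ψ' 0) v) := by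
    intro v
    have h1 := mfderiv_comp (mk3 ψ' 0) hqd hpd
    rw [hpar'] at h1
    exact DFunLike.congr_fun h1 v
  have hQ0 : Q (mk3 ψ' 0) = 0 := by
    show ob.qmap j (ob'.param i (mk3 ψ' 0)) = 0
    rw [hpar', ← hjx, qmap_tube]
  -- points of `param' i` near `p₀'` lie in the (open) image of `tube j`
  have hnear : ∀ e : EuclideanSpace ℝ (Fin 3), ∀ᶠ t in 𝓝 (0 : ℝ),
      ob'.param i (mk3 ψ' 0 + t • e) ∈ range (ob.tube j) := by
    intro e
    have hc : Continuous fun t : ℝ => ob'.param i (mk3 ψ' 0 + t • e) :=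
      (ob'.continuous_param i).comp (continuous_const.add (continuous_id.smul continuous_const))
    have h0 : ob'.param i (mk3 ψ' 0 + (0 : ℝ) • e) ∈ range (ob.tube j) := by
      rw [zero_smul, add_zero, hpar']; exact hprange
    exact hc.continuousAt.preimage_mem_nhds ((ob.isOpen_range_tube j).mem_nhds h0)
  -- (1) `Q` vanishes along the core line `t ↦ p₀' + t e₀` (the cores agree), so `L e₀ = 0`
  have hline₀ : ∀ t : ℝ, mk3 ψ' 0 + t • stdBasis3 0 = mk3 (ψ' + t) 0 := by
    intro t; ext k; fin_cases k <;> simp [mk3, stdBasis3_apply]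
  have hLe₀ : L (stdBasis3 0) = 0 := by
    refine fderiv_apply_eq_zero_of_eventually_eq_zero hLf ?_
    filter_upwards [hnear (stdBasis3 0)] with t ht
    have hyB : ob'.param i (mk3 ψ' 0 + t • stdBasis3 0) ∈ ob.binding := by
      rw [← hB, hline₀, param_mk3]
      exact ob'.core_mem_binding i _
    obtain ⟨x₁, hx₁⟩ := ob.mem_range_core_of_mem_range_tube hyB ht
    show ob.qmap j (ob'.param i (mk3 ψ' 0 + t • stdBasis3 0)) = 0
    rw [← hx₁]
    exact ob.qmap_tube j x₁ 0
  -- (2) `Q` preserves the directions of the disc lines `t ↦ p₀' + t e`, `πw e = ε ≠ 0`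
  have hdir : ∀ (e : EuclideanSpace ℝ (Fin 3)) (ε : EuclideanSpace ℝ (Fin 2)), ε ≠ 0 →
      (∀ t : ℝ, (mk3 ψ' 0 + t • e) 0 = ψ') → (∀ t : ℝ, πw (mk3 ψ' 0 + t • e) = t • ε) →
      ‖ε‖ • L e = ‖L e‖ • ε := by
    intro e ε hε he0 heπ
    refine fderiv_apply_direction_of_eventually hLf hQ0 ?_
    have hnear' : ∀ᶠ t in 𝓝[>] (0 : ℝ), ob'.param i (mk3 ψ' 0 + t • e) ∈ range (ob.tube j) :=
      (hnear e).filter_mono nhdsWithin_le_nhds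
    filter_upwards [hnear', self_mem_nhdsWithin] with t ht ht0
    have ht0' : (0 : ℝ) < t := ht0
    have hw : t • ε ≠ 0 := smul_ne_zero ht0'.ne' hε
    have hy : ob'.param i (mk3 ψ' 0 + t • e) = ob'.tube i (circlePoint ψ', t • ε) := by
      rw [OpenBook.param, he0, heπ]
    have hyB : ob'.param i (mk3 ψ' 0 + t • e) ∉ ob.binding := by
      rw [← hB, hy, ob'.tube_mem_binding_iff]; exact hw
    obtain ⟨⟨x₁, w₁⟩, hq⟩ := ht
    have hw₁ : w₁ ≠ 0 := by
      rintro rfl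
      exact hyB (hq ▸ ob.core_mem_binding j x₁)
    -- both fibrations have the normal form at this point: `w₁/‖w₁‖ = π = (tε)/‖tε‖ = ε/‖ε‖`
    have h1 : (ob.proj (ob'.param i (mk3 ψ' 0 + t • e)) : EuclideanSpace ℝ (Fin 2)) =
        ‖w₁‖⁻¹ • w₁ := by
      rw [← hq]; exact ob.proj_tube j x₁ w₁ hw₁
    have h2 : (ob'.proj (ob'.param i (mk3 ψ' 0 + t • e)) : EuclideanSpace ℝ (Fin 2)) =
        ‖t • ε‖⁻¹ • (t • ε) := by
      rw [hy]; exact ob'.proj_tube i (circlePoint ψ') (t • ε) hw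
    have h12 : ‖t • ε‖⁻¹ • (t • ε) = ‖w₁‖⁻¹ • w₁ := by
      rw [← h1, ← h2, hπ _ hyB]
    have hQt : Q (mk3 ψ' 0 + t • e) = w₁ := by
      show ob.qmap j (ob'.param i (mk3 ψ' 0 + t • e)) = w₁
      rw [← hq, qmap_tube]
    rw [hQt]
    have hεn : ‖ε‖ ≠ 0 := norm_ne_zero_iff.2 hε
    have hw₁n : ‖w₁‖ ≠ 0 := norm_ne_zero_iff.2 hw₁
    have h3 : ‖t • ε‖⁻¹ • (t • ε) = ‖ε‖⁻¹ • ε := by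
      rw [norm_smul, Real.norm_eq_abs, abs_of_pos ht0', smul_smul, mul_inv_rev, mul_assoc,
        inv_mul_cancel₀ ht0'.ne', mul_one]
    rw [h3] at h12
    have h4 := congrArg (fun z : EuclideanSpace ℝ (Fin 2) => (‖ε‖ * ‖w₁‖) • z) h12
    simp only [smul_smul] at h4
    have h5 : ‖ε‖ * ‖w₁‖ * ‖ε‖⁻¹ = ‖w₁‖ := by field_simp
    have h6 : ‖ε‖ * ‖w₁‖ * ‖w₁‖⁻¹ = ‖ε‖ := by field_simp
    rw [h5, h6] at h4
    exact h4.symm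
  have hline₁ : ∀ t : ℝ, (mk3 ψ' 0 + t • stdBasis3 1) 0 = ψ' := by
    intro t; simp [mk3, stdBasis3_apply]
  have hline₁' : ∀ t : ℝ, πw (mk3 ψ' 0 + t • stdBasis3 1) = t • EuclideanSpace.single 0 1 := by
    intro t; rw [map_add, map_smul, πw_mk3, πw_stdBasis3_one, zero_add]
  have hline₂ : ∀ t : ℝ, (mk3 ψ' 0 + t • stdBasis3 2) 0 = ψ' := by
    intro t; simp [mk3, stdBasis3_apply]
  have hline₂' : ∀ t : ℝ, πw (mk3 ψ' 0 + t • stdBasis3 2) = t • EuclideanSpace.single 1 1 := by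
    intro t; rw [map_add, map_smul, πw_mk3, πw_stdBasis3_two, zero_add]
  have hε₀ : (EuclideanSpace.single 0 1 : EuclideanSpace ℝ (Fin 2)) ≠ 0 := by
    intro h0; have := congrArg (fun z : EuclideanSpace ℝ (Fin 2) => z 0) h0; simp at this
  have hε₁ : (EuclideanSpace.single 1 1 : EuclideanSpace ℝ (Fin 2)) ≠ 0 := by
    intro h0; have := congrArg (fun z : EuclideanSpace ℝ (Fin 2) => z 1) h0; simp at this
  have hn₀ : ‖(EuclideanSpace.single 0 1 : EuclideanSpace ℝ (Fin 2))‖ = 1 := by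
    rw [EuclideanSpace.norm_eq]; simp
  have hn₁ : ‖(EuclideanSpace.single 1 1 : EuclideanSpace ℝ (Fin 2))‖ = 1 := by
    rw [EuclideanSpace.norm_eq]; simp
  -- so `L e₁ = μ₁ (1, 0)` and `L e₂ = μ₂ (0, 1)` with `μ₁, μ₂ ≥ 0`
  set μ₁ : ℝ := ‖L (stdBasis3 1)‖ with hμ₁
  set μ₂ : ℝ := ‖L (stdBasis3 2)‖ with hμ₂
  have hL₁ : L (stdBasis3 1) = μ₁ • EuclideanSpace.single 0 1 := by
    have h1 := hdir (stdBasis3 1) _ hε₀ hline₁ hline₁'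
    rwa [hn₀, one_smul] at h1
  have hL₂ : L (stdBasis3 2) = μ₂ • EuclideanSpace.single 1 1 := by
    have h1 := hdir (stdBasis3 2) _ hε₁ hline₂ hline₂'
    rwa [hn₁, one_smul] at h1
  -- the frame `(b', e₁', e₂')` of `ob'` at `p` is `d(param' i)(c' e₀, e₁, e₂)`, `c' ≠ 0`
  have hb' : mfderiv (𝓡 3) (𝓡 3) (ob'.param i) (mk3 ψ' 0) (stdBasis3 0) =
      circleSpeed ψ' • ob'.coreTangent i (circlePoint ψ') := by
    rw [ob'.mfderiv_param_stdBasis3_zero i, mk3_apply_zero, πw_mk3, psiTangent_zero]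
  have he₁' : mfderiv (𝓡 3) (𝓡 3) (ob'.param i) (mk3 ψ' 0) (stdBasis3 1) =
      ob'.discFrame i (circlePoint ψ') 0 := by
    rw [ob'.mfderiv_param_stdBasis3_one i, mk3_apply_zero, πw_mk3, wTangent_zero]
  have he₂' : mfderiv (𝓡 3) (𝓡 3) (ob'.param i) (mk3 ψ' 0) (stdBasis3 2) =
      ob'.discFrame i (circlePoint ψ') 1 := by
    rw [ob'.mfderiv_param_stdBasis3_two i, mk3_apply_zero, πw_mk3, wTangent_zero]
  -- hence `Dq b' = 0`, `Dq e₁' = μ₁ (1, 0)`, `Dq e₂' = μ₂ (0, 1)`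
  have hDb' : Dq (ob'.coreTangent i (circlePoint ψ')) = 0 := by
    have h1 := hchain (stdBasis3 0)
    rw [hLe₀, hb', map_smul] at h1
    exact (smul_eq_zero.1 h1.symm).resolve_left (circleSpeed_ne_zero ψ')
  have hDe₁' : Dq (ob'.discFrame i (circlePoint ψ') 0) = μ₁ • EuclideanSpace.single 0 1 := by
    rw [← he₁', ← hchain]; exact hL₁
  have hDe₂' : Dq (ob'.discFrame i (circlePoint ψ') 1) = μ₂ • EuclideanSpace.single 1 1 := by
    rw [← he₂', ← hchain]; exact hL₂
  -- coordinates of `(b', e₁', e₂')` in the frame `(b, e₁, e₂)`: `ker Dq = ℝ b`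
  set a : ℝ := GrayMoser.det3 (ob'.coreTangent i (circlePoint ψ'))
      (ob.discFrame j (circlePoint ψ) 0) (ob.discFrame j (circlePoint ψ) 1) /
    GrayMoser.det3 (ob.coreTangent j (circlePoint ψ)) (ob.discFrame j (circlePoint ψ) 0)
      (ob.discFrame j (circlePoint ψ) 1) with ha
  set c₁ : ℝ := GrayMoser.det3 (ob'.discFrame i (circlePoint ψ') 0)
      (ob.discFrame j (circlePoint ψ) 0) (ob.discFrame j (circlePoint ψ) 1) /
    GrayMoser.det3 (ob.coreTangent j (circlePoint ψ)) (ob.discFrame j (circlePoint ψ) 0)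
      (ob.discFrame j (circlePoint ψ) 1) with hc₁
  set c₂ : ℝ := GrayMoser.det3 (ob'.discFrame i (circlePoint ψ') 1)
      (ob.discFrame j (circlePoint ψ) 0) (ob.discFrame j (circlePoint ψ) 1) /
    GrayMoser.det3 (ob.coreTangent j (circlePoint ψ)) (ob.discFrame j (circlePoint ψ) 0)
      (ob.discFrame j (circlePoint ψ) 1) with hc₂
  have hb'eq : ob'.coreTangent i (circlePoint ψ') = a • ob.coreTangent j (circlePoint ψ) := by
    have h1 := GrayMoser.eq_frame_of_apply Dq hDb hDe₁ hDe₂ hdet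
      (ob'.coreTangent i (circlePoint ψ'))
    rw [hDb'] at h1
    simpa using h1
  have he₁'eq : ob'.discFrame i (circlePoint ψ') 0 = c₁ • ob.coreTangent j (circlePoint ψ) +
      μ₁ • ob.discFrame j (circlePoint ψ) 0 + (0 : ℝ) • ob.discFrame j (circlePoint ψ) 1 := by
    have h1 := GrayMoser.eq_frame_of_apply Dq hDb hDe₁ hDe₂ hdet
      (ob'.discFrame i (circlePoint ψ') 0)
    rw [hDe₁'] at h1
    simpa using h1
  have he₂'eq : ob'.discFrame i (circlePoint ψ') 1 = c₂ • ob.coreTangent j (circlePoint ψ) +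
      (0 : ℝ) • ob.discFrame j (circlePoint ψ) 0 + μ₂ • ob.discFrame j (circlePoint ψ) 1 := by
    have h1 := GrayMoser.eq_frame_of_apply Dq hDb hDe₁ hDe₂ hdet
      (ob'.discFrame i (circlePoint ψ') 1)
    rw [hDe₂'] at h1
    simpa using h1
  -- `a ≠ 0` and `μ₁, μ₂ > 0`, because the differential of `tube' i` is injective
  have ha0 : a ≠ 0 := by
    intro h0
    apply ob'.coreTangent_ne_zero i (circlePoint ψ')
    rw [hb'eq, h0, zero_smul]
  have hμ₁0 : μ₁ ≠ 0 := by
    intro h0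
    refine ob'.discFrame_ne_smul_coreTangent i (circlePoint ψ') 0 (c₁ / a) ?_
    rw [he₁'eq, h0, hb'eq, zero_smul, zero_smul, add_zero, add_zero, smul_smul,
      div_mul_cancel₀ _ ha0]
  have hμ₂0 : μ₂ ≠ 0 := by
    intro h0
    refine ob'.discFrame_ne_smul_coreTangent i (circlePoint ψ') 1 (c₂ / a) ?_
    rw [he₂'eq, h0, hb'eq, zero_smul, zero_smul, add_zero, add_zero, smul_smul,
      div_mul_cancel₀ _ ha0]
  have hμ₁p : 0 < μ₁ := lt_of_le_of_ne (norm_nonneg _) (Ne.symm hμ₁0)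
  have hμ₂p : 0 < μ₂ := lt_of_le_of_ne (norm_nonneg _) (Ne.symm hμ₂0)
  -- conclusion: `α(b') W(b', e₁', e₂') = a² μ₁ μ₂ · α(b) W(b, e₁, e₂) > 0`
  have hdet' : GrayMoser.det3 (ob'.coreTangent i (circlePoint ψ'))
      (ob'.discFrame i (circlePoint ψ') 0) (ob'.discFrame i (circlePoint ψ') 1) =
      a * (μ₁ * μ₂) * GrayMoser.det3 (ob.coreTangent j (circlePoint ψ))
        (ob.discFrame j (circlePoint ψ) 0) (ob.discFrame j (circlePoint ψ) 1) := by
    rw [hb'eq, he₁'eq, he₂'eq, GrayMoser.det3_frame_change]; ring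
  have hαb' : α p ![ob'.coreTangent i (circlePoint ψ')] =
      a * α p ![ob.coreTangent j (circlePoint ψ)] := by
    rw [hb'eq]; exact oneForm_apply_smul_vec _ a _
  have key : α p ![ob'.coreTangent i (circlePoint ψ')] *
      wedge₁₂ (α p) (mextDeriv α p) (ob'.coreTangent i (circlePoint ψ'))
        (ob'.discFrame i (circlePoint ψ') 0) (ob'.discFrame i (circlePoint ψ') 1) =
      a ^ 2 * (μ₁ * μ₂) * (α p ![ob.coreTangent j (circlePoint ψ)] *
        wedge₁₂ (α p) (mextDeriv α p) (ob.coreTangent j (circlePoint ψ))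
          (ob.discFrame j (circlePoint ψ) 0) (ob.discFrame j (circlePoint ψ) 1)) := by
    rw [GrayMoser.wedge₁₂_eq_det3_mul_vol, GrayMoser.wedge₁₂_eq_det3_mul_vol, hαb', hdet']
    ring
  rw [key]
  have ha2 : 0 < a ^ 2 := by positivity
  exact mul_pos (mul_pos ha2 (mul_pos hμ₁p hμ₂p)) hbind

/-- **A Giroux form sees an open book only through `(B, π)`.**  If `ob` and `ob'` are open books
of the Hausdorff `3`-manifold `M` with the same binding and the same fibration off the binding,
then every Giroux form `α` of `ob` for the plane field `ξ` is a Giroux form of `ob'` for `ξ`: the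
printed notion "`ξ` is supported by `(B, π)`" (Etnyre 2006, Def. 3.2; Wendl 2020, p. 77) does
not depend on the tubes chosen around the binding. [cite: Etnyre2006, Def. 3.2] -/
theorem IsGirouxForm.of_binding_eq_of_proj_eq [T2Space M] {ob ob' : OpenBook M}
    {ξ : M → Submodule ℝ (EuclideanSpace ℝ (Fin 3))} {α : MForm (𝓡 3) M ℝ 1}
    (h : ob.IsGirouxForm ξ α) (hB : ob'.binding = ob.binding)
    (hπ : ∀ y, y ∉ ob.binding → ob'.proj y = ob.proj y) : ob'.IsGirouxForm ξ α where
  smooth := h.smooth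
  ker_eq := h.ker_eq
  contact := h.contact
  pages y hy n u v hn hu hv := by
    rw [hB] at hy
    rw [angularDeriv_eq_of_eqOn hπ hy] at hn hu hv
    exact h.pages y hy n u v hn hu hv
  binding i x := h.binding_of_binding_eq_of_proj_eq hB hπ i x

/-- For two open books with the same binding and the same fibration off the binding, the Giroux
forms (for any plane field) are the same. [cite: Etnyre2006, Def. 3.2] -/
theorem isGirouxForm_iff_of_binding_eq_of_proj_eq [T2Space M] {ob ob' : OpenBook M}
    (hB : ob'.binding = ob.binding) (hπ : ∀ y, y ∉ ob.binding → ob'.proj y = ob.proj y)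
    (ξ : M → Submodule ℝ (EuclideanSpace ℝ (Fin 3))) (α : MForm (𝓡 3) M ℝ 1) :
    ob'.IsGirouxForm ξ α ↔ ob.IsGirouxForm ξ α :=
  ⟨fun h => h.of_binding_eq_of_proj_eq hB.symm fun y hy => (hπ y (by rwa [← hB])).symm,
    fun h => h.of_binding_eq_of_proj_eq hB hπ⟩

/-- **"Supported by `(B, π)`" is well defined**: open books with the same binding and the same
fibration off the binding support the same plane fields. [cite: Etnyre2006, Def. 3.2] -/
theorem Supports.of_binding_eq_of_proj_eq [T2Space M] {ob ob' : OpenBook M}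
    {ξ : M → Submodule ℝ (EuclideanSpace ℝ (Fin 3))} (h : ob.Supports ξ)
    (hB : ob'.binding = ob.binding) (hπ : ∀ y, y ∉ ob.binding → ob'.proj y = ob.proj y) :
    ob'.Supports ξ := by
  obtain ⟨α, hα⟩ := h
  exact ⟨α, hα.of_binding_eq_of_proj_eq hB hπ⟩

end OpenBook

end Literature.Geometry.Symplectic
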